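import Literature.MathematicalPhysics.QuantumFieldTheory.UnitaryHaarVolume
import Summits.Ventures.LatticeQCDFlow.Scaling.SmallBallChartLimit
import Summits.Ventures.LatticeQCDFlow.Scaling.CalibratedWindow
import Summits.Ventures.LatticeQCDFlow.Scaling.ExactTransportUN

/-!
# LatticeQCDFlow / Scaling — exact small-ball asymptotics of `U(N)` and the CONSTANT-FREE calibrated window laws

HONEST FRAMING: exact (Metropolis-corrected) sampling algorithms for lattice gauge theory; figures of merit are
autocorrelation/cost numbers at stated couplings and volumes; no continuum-physics claim.

Venture `LatticeQCDFlow` (cell pub-lqcd), topic `Scaling`, FANOUT row 30 (lean-1) — OUR WORK, discharging theory-2's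
hypothesis item `SmallBallAsymptotics` (`Scaling/CalibratedWindowSteps.lean`, THEORY-2.md §3.3 v2.9) for the unitary
group `U(N)` with the Hilbert–Schmidt (Frobenius) distance, every `N`:

* `UN.tendsto_haar_closedBall_div_pow` — `Haar(B̄(g, t))/t^{N²} → c_N` as `t → 0⁺`, for EVERY centre `g`, with
  Chatterjee's constant `c_N = ∏_{j<N} j! / ((2π)^{N/2} 2^{N²/2} Γ(N²/2+1)) > 0` (the tree's
  `UnitaryColumn.tendsto_haar_gball_div`, arXiv:1602.01222 Thm. 6.1, proved in `Literature/…/UnitaryHaarVolume`,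
  plus left invariance of Hilbert–Schmidt balls `UN.haar_closedBall`);
* `UN.smallBallAsymptotics N : SmallBallAsymptotics U(N) (N·N)` — the item DISCHARGED (`two_sided_of_tendsto`);
* `UN.calibratedCoolingWindow_zero d N : CalibratedCoolingWindow d N U(N) ρ_fund (N·N) 0` and
  `UN.calibratedHeatingWindow_zero d N` — the CONSTANT-FREE calibrated window laws for `U(N)`, NO hypothesis left:
  every exact `K`-Lipschitz cooling transport `T_* μ_{Λ,β₀} = μ_{Λ,β}` (`0 ≤ β₀ ≤ β`) of `U(N)` Wilson laws satisfies
  `N²·#E·log K ≥ (β - β₀)·(S(U) - ⟨S⟩_{β₀})` for EVERY configuration `U` (item 68's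
  `calibratedCoolingWindow_of_smallBallAsymptotics`; `UN.calibratedWindow` had an unspecified constant `C`).

The instance arguments of the items are written out (`Subtype.metricSpace` and the tree's `UN.*_hs` instances), as in
`Scaling/ExactTransportUN.lean`.  Nothing here is cited as a fact.
-/

noncomputable section

open scoped Matrix.Norms.Frobenius
open MeasureTheory Metric Set Filter Topology Real
open Literature.MathematicalPhysics.QuantumFieldTheory
open Literature.MathematicalPhysics.QuantumFieldTheory.UnitaryCayley (𝔾 gball)
open Literature.MathematicalPhysics.QuantumLattice (unitaryFundamentalRep continuous_unitaryFundamentalRep)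

namespace Summit.Ventures.LatticeQCDFlow.Theory2.Lattice.UN

variable {N : ℕ}

/-- **Chatterjee's small-ball constant of `U(N)` is positive.** [folklore] -/
theorem chatterjeeConst_pos (N : ℕ) :
    0 < (∏ j ∈ Finset.range N, (j.factorial : ℝ)) /
      ((2 * π) ^ ((N : ℝ) / 2) * 2 ^ ((N : ℝ) ^ 2 / 2) * Real.Gamma ((N : ℝ) ^ 2 / 2 + 1)) := by
  apply div_pos
  · exact Finset.prod_pos fun j _ => by exact_mod_cast Nat.factorial_pos j
  · have h1 : 0 < (2 * π) ^ ((N : ℝ) / 2) := Real.rpow_pos_of_pos (by positivity) _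
    have h2 : 0 < (2 : ℝ) ^ ((N : ℝ) ^ 2 / 2) := Real.rpow_pos_of_pos two_pos _
    have h3 : 0 < Real.Gamma ((N : ℝ) ^ 2 / 2 + 1) := Real.Gamma_pos_of_pos (by positivity)
    positivity

/-- **Exact small-ball asymptotics of `U(N)` about every centre**: `Haar(B̄(g, t))/t^{N²} → c_N` as `t → 0⁺`
(Hilbert–Schmidt balls are left translates of the ball about `1`; Chatterjee arXiv:1602.01222 Thm. 6.1 for the
constant). [folklore] -/
theorem tendsto_haar_closedBall_div_pow (g : 𝔾 N) :
    Tendsto (fun t : ℝ => (haarProbability (𝔾 N) (closedBall g t)).toReal / t ^ (N * N)) (𝓝[>] 0)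
      (𝓝 ((∏ j ∈ Finset.range N, (j.factorial : ℝ)) /
        ((2 * π) ^ ((N : ℝ) / 2) * 2 ^ ((N : ℝ) ^ 2 / 2) * Real.Gamma ((N : ℝ) ^ 2 / 2 + 1)))) := by
  simp_rw [haar_closedBall g]
  exact UnitaryColumn.tendsto_haar_gball_div N

/-- **`SmallBallAsymptotics U(N) N²` — theory-2's hypothesis item DISCHARGED for `U(N)`** (Hilbert–Schmidt metric,
every `N`): for every `ε > 0` there are `r₁ > 0`, `0 < a`, `A ≤ (1+ε)a` with `a·t^{N²} ≤ Haar(B̄(g,t)) ≤ A·t^{N²}`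
for all `g` and `0 < t ≤ r₁`. [folklore] -/
theorem smallBallAsymptotics (N : ℕ) :
    @SmallBallAsymptotics (𝔾 N) _ Subtype.metricSpace isTopologicalGroup_hs compactSpace_hs _ borelSpace_hs
      (N * N) :=
  SmallBallChart.two_sided_of_tendsto (σ := haarProbability (𝔾 N)) (x₀ := (1 : 𝔾 N))
    (fun g r => by rw [haar_closedBall g r, haar_closedBall (1 : 𝔾 N) r]) (chatterjeeConst_pos N)
    (tendsto_haar_closedBall_div_pow 1)

/-- **(C2a-W⁺) CONSTANT-FREE for `U(N)`** (OURS; every `N`, `d`, Hilbert–Schmidt metric): every exact `K`-Lipschitz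
cooling transport `T_* μ_{Λ,β₀} = μ_{Λ,β}`, `0 ≤ β₀ ≤ β`, of `U(N)` Wilson laws (fundamental representation) satisfies
`(β - β₀)·(S(U) - ⟨S⟩_{Λ,β₀}) ≤ N²·#E·log K` for every `L` and EVERY configuration `U`. [folklore] -/
theorem calibratedCoolingWindow_zero (d N : ℕ) :
    @CalibratedCoolingWindow d N (𝔾 N) _ Subtype.metricSpace isTopologicalGroup_hs compactSpace_hs _ borelSpace_hs
      (unitaryFundamentalRep (Fin N) ℂ) (N * N) 0 :=
  @calibratedCoolingWindow_of_smallBallAsymptotics N (𝔾 N) _ Subtype.metricSpace isTopologicalGroup_hs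
    compactSpace_hs secondCountable_hs _ borelSpace_hs (unitaryFundamentalRep (Fin N) ℂ) d
    (continuous_unitaryFundamentalRep (Fin N) ℂ) re_trace_le neg_le_re_trace (N * N) (smallBallAsymptotics N)

/-- **(C2a-H⁺) CONSTANT-FREE for `U(N)`** (OURS): every exact `K'`-co-Lipschitz heating transport
`T_* μ_{Λ,β₀} = μ_{Λ,β}`, `0 ≤ β ≤ β₀`, of `U(N)` Wilson laws satisfies `(β₀ - β)·(S(U) - ⟨S⟩_{Λ,β}) ≤ N²·#E·log K'`
for every `L` and every `U`. [folklore] -/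
theorem calibratedHeatingWindow_zero (d N : ℕ) :
    @CalibratedHeatingWindow d N (𝔾 N) _ Subtype.metricSpace isTopologicalGroup_hs compactSpace_hs _ borelSpace_hs
      (unitaryFundamentalRep (Fin N) ℂ) (N * N) 0 :=
  @calibratedHeatingWindow_of_smallBallAsymptotics N (𝔾 N) _ Subtype.metricSpace isTopologicalGroup_hs
    compactSpace_hs secondCountable_hs _ borelSpace_hs (unitaryFundamentalRep (Fin N) ℂ) d
    (continuous_unitaryFundamentalRep (Fin N) ℂ) re_trace_le (N * N) (smallBallAsymptotics N)

end Summit.Ventures.LatticeQCDFlow.Theory2.Lattice.UN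

end
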